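import Summits.HodgeConjecture.HodgeConjecture.Cruxes.BlochSeedDiscOne.DiamondLevelLaws

/-!
# FlatApex — the node-flat base family (F1) of the `K`-peel dies by RULE D + A2I⁻ + S₄ (control g17, crux `BlochSeedDiscOne`, H2)

KERNEL, `h`-UNIFORM, LAW-LEVEL (no census, no `decide`): in a two-level first-order design `C` in the diamond `◇_h` (`h` even) obeying
RULE D (`RuleDMu4Closed`), the A2I⁻ static law (`A2IMinusClosed`) and slot symmetry of the `N`-level (`PermClosed C.lower`, part of `G1Closed`),
and in which the INTERFACE one-apex `K`-cells (`InterfaceKAbsent`) and the four-charged `K_P`-cells are absent, there is NO node-flat one-apex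
`K_N`-head `Z = N{ℓI, x₁, x₂, x₃}` (`node(x_i) = ℓ`): `flatApex_absent`.  Together with `PairSpread` v12 (`fourChargedK_absent_of_interface` :
interface ⟹ four-charged, and `kAbsent_iff_core` : `KAbsent ↔ interface ∧ twin-apex ∧ F1`; the definitions below are restated from it verbatim)
this removes (F1) from the core:  **`KAbsent ⟸ InterfaceKAbsent ∧ TwinApexKAbsent`** under RULE D + A2I⁻ + S₄, for every even `h`.

MECHANISM (read off the census, then proved for all `h`).  In the ◇₈ ∕ ◇₁₀ UNSAT peels (gs-eng-2 g54 job j318002, peel tables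
`h8/peel_table.txt.gz` sha16 `a459e02921a60310`, `h10/peel_table.txt.gz` `74004db439790926`; bc5-plan g8 ◇₈ r3 j305149, ◇₁₀ G₁ j308425) every
F1 orbit (330 ∕ 330 at ◇₈, 715 ∕ 715 at ◇₁₀; `tools/f1check.py`, tables `data/f1check_h8.txt`, `data/f1check_h10.txt`) is unit-killed by the
same two clauses, and both are `h`-free:
* STEP A (RULE D below `Z` at the pair (apex `p`, any direction) ∕ (charged slot `σ`, its top direction `u`)): every serving `P`-cell is a
  four-charged non-level cell, an interface cell (`LowApexP`), a LOW-TWO one-apex cell (`LowTwo`: apex with exactly one charged top at or below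
  it — here AT it) or the FULL DESCENT `q = Z[σ ↦ ℓI]`; so `q ∈ C.upper` (`flat_descent_present`).
* STEP B (the A2I⁻ instance `(Z; σ, u; q; f' = p, v = u; N' = Z ∘ (p σ))`, `N' ∈ C.lower` by `PermClosed`): every escape clause of
  `XresA2IFires` is witnessed only by four-charged non-level, interface or low-two `P`-cells (§4), so the instance fires — contradicting `A2IMinusClosed`.
The low-two cells are themselves absent given the four-charged ones, by a Ψ-induction (pairwise spread, `PairSpread` §3) whose steps RULE A∕PA
keep the slot pair and the tops (§2–§3; no interface hypothesis is needed there).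

WHAT THIS DOES NOT PROVE.  `InterfaceKAbsent`, `TwinApexKAbsent`, hence `KAbsent`, (A₃), (T_h) = `SeedB1OddDiamondG1H1 h` (kernel-FALSE for even
`h ≥ 12`, census-UNSAT at 8, 10 — NOT kernel), the crux H2 `BlochSeedDiscOne`, HC_CM, HC_AV and HC are NOT proved here and are not claimed;
HC_CM is not used and enters nowhere.  No `sorry`, no new axiom, no `instance`, no notation.  Imports `DiamondLevelLaws` only; §0 restates the
needed `PairSpread` v12 (sha16 `dd96514bfe99174c`) vocabulary and helper lemmas VERBATIM (that module is not yet built on the farm, so it cannot be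
imported; the restated definitions are syntactically identical, so the bridge to `PairSpread.kAbsent_iff_core` is `Iff.rfl` once both build).
-/

set_option linter.dupNamespace false

namespace Summit.HodgeConjecture.HodgeConjecture.Cruxes.BlochSeedDiscOne.FlatApex

open Finset Summit.Ventures.HSemireg.Pad4Tower
open Summit.HodgeConjecture.HodgeConjecture.Cruxes.BlochSeedDiscOne.DiamondLevelLaws

/-! ## §0 Vocabulary and helpers restated verbatim from `PairSpread` v12 (its §0–§3, §5–§6 fragments) and `ChargeInduction` v11 -/

theorem absCharge_of_uncharged {x : BPoint} (h0 : x.2 = (0, 0)) : absCharge x = 0 := by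
  simp [absCharge, chargeOf, h0]

theorem coord_add_coord_add_two (x : BPoint) (m : Fin 4) : coord x m + coord x (m + 2) = 2 * x.1 := by
  fin_cases m <;> simp [coord] <;> ring

theorem adapted_add_two {x : BPoint} {m : Fin 4} (hm : Adapted x m) : Adapted x (m + 2) := by
  fin_cases m <;> simpa [Adapted] using hm

/-- every μ₄ letter has a TOP direction: an adapted coordinate of value `α + |c|`. -/
theorem exists_top_dir' {x : BPoint} (hxax : x.2 = (0, 0) ∨ AxisPt x) : ∃ k : Fin 4, Adapted x k ∧ coord x k = x.1 + absCharge x := by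
  obtain ⟨m, hm, hm0⟩ := exists_node_dir hxax
  exact ⟨m + 2, adapted_add_two hm, by have := coord_add_coord_add_two x m; omega⟩

/-- the LINE CHILD: `e > 0` null steps below a charged letter off the antipode of its node direction keep the top and lower the node by `2e`. -/
theorem lineChild_of_ray {x y : BPoint} {m r : Fin 4} {e : ℤ} (hxax : x.2 = (0, 0) ∨ AxisPt x) (hna : x.2 ≠ (0, 0))
    (hm : Adapted x m) (hm0 : coord x m = x.1 - absCharge x) (hr : r ≠ m + 2) (he : 0 < e) (hxy : x = ray y r e)
    (hyax : y.2 = (0, 0) ∨ AxisPt y) (hy : absCharge y ≤ y.1) :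
    y.2 ≠ (0, 0) ∧ causalTop y = causalTop x ∧ nodeLevel y + 2 * e = nodeLevel x := by
  obtain ⟨α, a, b⟩ := y
  subst hxy
  simp only [causalTop, nodeLevel, absCharge, chargeOf, coord, AxisPt, Adapted, Prod.mk.injEq, ne_eq] at *
  fin_cases m <;> fin_cases r <;> simp at hxax hna hm hm0 hr hyax hy ⊢ <;>
    (simp only [abs_eq_max_neg, max_def] at *; split_ifs at * <;> omega)

/-- the APEX LOWERING: if the apex `aI` is `d > 0` null steps (any direction) above `y`, then `y` is charged with causal top `a` and charge `d`. -/
theorem apexLower_of_ray {a : ℤ} {y : BPoint} {r : Fin 4} {d : ℤ} (hd : 0 < d) (hy : ((a, 0, 0) : BPoint) = ray y r d) :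
    y.2 ≠ (0, 0) ∧ causalTop y = a ∧ absCharge y = d := by
  obtain ⟨α, p, q⟩ := y
  simp only [causalTop, absCharge, chargeOf, ne_eq, Prod.mk.injEq]
  fin_cases r <;> simp [ray, Prod.ext_iff] at hy ⊢ <;> (simp only [abs_eq_max_neg, max_def] at *; split_ifs at * <;> omega)

/-! ## §1 The three shapes of a RULE-D outcome at one letter -/

/-- `y` is a DESCENT of `x`: same node level, strictly lower causal top (partial descent `−e`, or the full descent to the apex `nI`). -/
def DescOf (x y : BPoint) : Prop := nodeLevel y = nodeLevel x ∧ causalTop y < causalTop x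

/-- `y` is an OVERSHOOT of `x`: charged, causal top = the node level of `x`, node strictly lower (the top ray continued through the apex `nI`). -/
def OverOf (x y : BPoint) : Prop := y.2 ≠ (0, 0) ∧ causalTop y = nodeLevel x ∧ nodeLevel y < nodeLevel x

/-- `y` is a DROP of `x`: charged, same causal top, node strictly lower (a charged letter charging deeper, or an apex lowered to a line letter). -/
def DropOf (x y : BPoint) : Prop := y.2 ≠ (0, 0) ∧ causalTop y = causalTop x ∧ nodeLevel y < nodeLevel x

/-- **the full top-child geometry**: `e > 0` null steps below a charged μ₄ letter `x` along a direction `r ≠ k + 2` (`k` the top direction of `x`),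
staying a μ₄ letter, is a DESCENT (`node =`, top `−2e`, charge `−e`) or an OVERSHOOT (`node <`, top = old node, node = old top `− 2e`). -/
theorem topChild_full {x y : BPoint} {k r : Fin 4} {e : ℤ} (hxax : x.2 = (0, 0) ∨ AxisPt x) (hna : x.2 ≠ (0, 0))
    (hk : Adapted x k) (hk0 : coord x k = x.1 + absCharge x) (hr : r ≠ k + 2) (he : 0 < e) (hxy : x = ray y r e)
    (hyax : y.2 = (0, 0) ∨ AxisPt y) (hy : absCharge y ≤ y.1) :
    (nodeLevel y = nodeLevel x ∧ causalTop y + 2 * e = causalTop x ∧ absCharge y + e = absCharge x) ∨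
    (y.2 ≠ (0, 0) ∧ causalTop y = nodeLevel x ∧ nodeLevel y + 2 * e = causalTop x ∧ absCharge x + absCharge y = e) := by
  obtain ⟨α, a, b⟩ := y
  subst hxy
  simp only [causalTop, nodeLevel, absCharge, chargeOf, coord, AxisPt, Adapted, Prod.mk.injEq, ne_eq] at *
  fin_cases k <;> fin_cases r <;> simp at hxax hna hk hk0 hr hyax hy ⊢ <;>
    (simp only [abs_eq_max_neg, max_def] at *; split_ifs at * <;> omega)

/-- **the full node-child geometry**: `d > 0` null steps below a charged μ₄ letter `x` along its NODE direction `m` is a DROP (top `=`, node `−2d`,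
charge `+d`).  (`lineChild_of_ray` with `r = m`.) -/
theorem nodeChild_full {x y : BPoint} {m : Fin 4} {d : ℤ} (hxax : x.2 = (0, 0) ∨ AxisPt x) (hna : x.2 ≠ (0, 0))
    (hm : Adapted x m) (hm0 : coord x m = x.1 - absCharge x) (hd : 0 < d) (hxy : x = ray y m d)
    (hyax : y.2 = (0, 0) ∨ AxisPt y) (hy : absCharge y ≤ y.1) :
    y.2 ≠ (0, 0) ∧ causalTop y = causalTop x ∧ nodeLevel y + 2 * d = nodeLevel x :=
  lineChild_of_ray hxax hna hm hm0 (fin4_ne_add_two m) hd hxy hyax hy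

/-! ## §2 RULE D below an `N`-cell in OUTCOME FORM -/

/-- the outcome of the top coordinate of a charged letter `g` of `Z ∈ C.lower` settled below in a direction `r ≠ k+2`: a descent or an overshoot. -/
theorem topOutcome {h : ℤ} {C : MConfig} (hU : C.InDiamond h) {Z P : MCell} (hZ : Z ∈ C.lower) (hP : P ∈ C.upper) {g : Fin 4}
    (hgc : (Z g).2 ≠ (0, 0)) {k r : Fin 4} (hk : Adapted (Z g) k) (hk0 : coord (Z g) k = (Z g).1 + absCharge (Z g)) (hr : r ≠ k + 2)
    (hlt : (P g).1 < (Z g).1) (hray : Z g = ray (P g) r ((Z g).1 - (P g).1)) : DescOf (Z g) (P g) ∨ OverOf (Z g) (P g) := by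
  rcases topChild_full (hU.1 Z hZ g).1 hgc hk hk0 hr (by omega) hray (hU.2 P hP g).1 (hU.2 P hP g).2.1 with ⟨hn, ht, -⟩ | ⟨hc, ht, hn, -⟩
  · exact Or.inl ⟨hn, by omega⟩
  · refine Or.inr ⟨hc, ht, ?_⟩
    have := absCharge_nonneg (P g)
    have h1 : nodeLevel (Z g) + 2 * absCharge (Z g) = causalTop (Z g) := by unfold nodeLevel causalTop; ring
    have hcg : 0 < absCharge (Z g) := absCharge_pos_of_not_isApex (hU.1 Z hZ g).1 (not_isApex_of_snd_ne hgc)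
    have h2 : nodeLevel (P g) + 2 * absCharge (P g) = causalTop (P g) := by unfold nodeLevel causalTop; ring
    have hcp : 0 < absCharge (P g) := absCharge_pos_of_not_isApex (hU.2 P hP g).1 (not_isApex_of_snd_ne hc)
    omega

/-- the outcome of the node coordinate of a letter `j` of `Z ∈ C.lower` moved below in a direction `b ≠ m + 2` (`m` the node direction; for a
charged letter only `b = m` stays a μ₄ letter, for an apex every such `b` does): a DROP. -/
theorem nodeOutcome {h : ℤ} {C : MConfig} (hU : C.InDiamond h) {Z P : MCell} (hZ : Z ∈ C.lower) (hP : P ∈ C.upper) {j : Fin 4}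
    {m b : Fin 4} (hm : Adapted (Z j) m) (hm0 : coord (Z j) m = (Z j).1 - absCharge (Z j)) (hb : b ≠ m + 2)
    (hlt : (P j).1 < (Z j).1) (hray : Z j = ray (P j) b ((Z j).1 - (P j).1)) : DropOf (Z j) (P j) := by
  by_cases hj0 : (Z j).2 = (0, 0)
  · -- an apex lowered: charged, top = the apex height, charge d
    have hZj : Z j = ((Z j).1, 0, 0) := by ext <;> simp [hj0]
    rw [hZj] at hray
    obtain ⟨hc, ht, hq⟩ := apexLower_of_ray (by omega) hray
    have hta : causalTop (Z j) = (Z j).1 := by unfold causalTop; rw [absCharge_of_uncharged hj0]; ring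
    have hna : nodeLevel (Z j) = (Z j).1 := by unfold nodeLevel; rw [absCharge_of_uncharged hj0]; ring
    refine ⟨hc, by rw [ht, hta], ?_⟩
    unfold nodeLevel at hna ⊢; rw [hq]; omega
  · obtain ⟨hc, ht, hn⟩ := lineChild_of_ray (hU.1 Z hZ j).1 hj0 hm hm0 hb (by omega) hray (hU.2 P hP j).1 (hU.2 P hP j).2.1
    exact ⟨hc, ht, by omega⟩

theorem dirOK_ne_add_two {x : BPoint} {k a : Fin 4} (h : DirOK x k a) : a ≠ k + 2 :=
  h.elim (fun e => e ▸ fin4_ne_add_two a) fun h' => h'.2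

/-- **EDGE (tn) in OUTCOME FORM** (KERNEL, law-free, every `h`): RULE D at (top of the charged letter `g`, node of `j ≠ g`) below an `N`-cell `Z` with
`top(Z g) ≠ node(Z j)` is served by some `P ∈ C.upper` agreeing with `Z` off `{g, j}` whose `g`-letter is `Z g`, a descent or an overshoot of it, whose
`j`-letter is `Z j` or a drop of it, and which moves at least one of the two. -/
theorem edge_tn_outcomes {h : ℤ} {C : MConfig} (hU : C.InDiamond h) {Z : MCell} (hZ : Z ∈ C.lower) (hD : RuleDMu4N C Z) {g j : Fin 4}
    (hgj : g ≠ j) (hgc : (Z g).2 ≠ (0, 0)) (hne : causalTop (Z g) ≠ nodeLevel (Z j)) :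
    ∃ P ∈ C.upper, MAgree2 P Z g j ∧ (P g = Z g ∨ DescOf (Z g) (P g) ∨ OverOf (Z g) (P g)) ∧ (P j = Z j ∨ DropOf (Z j) (P j)) ∧
      (P g ≠ Z g ∨ P j ≠ Z j) := by
  obtain ⟨k, hk, hk0⟩ := exists_top_dir' (hU.1 Z hZ g).1
  obtain ⟨m, hm, hm0⟩ := exists_node_dir (hU.1 Z hZ j).1
  have hne' : coord (Z g) k ≠ coord (Z j) m := by rw [hk0, hm0]; unfold causalTop nodeLevel at hne; exact hne
  rcases hD g j hgj k m hk hm hne' with ⟨r, hr, P, hP, hag, hlt, hray⟩ | ⟨r, hr, P, hP, hag, hlt, hray⟩ |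
      ⟨a, b, ha, hb, P, hP, hag2, hlt1, hray1, hlt2, hray2⟩
  · refine ⟨P, hP, fun f hf _ => hag f hf, Or.inr (topOutcome hU hZ hP hgc hk hk0 hr hlt hray), Or.inl (hag j hgj.symm), Or.inl ?_⟩
    intro e; rw [e] at hlt; exact lt_irrefl _ hlt
  · refine ⟨P, hP, fun f _ hf => hag f hf, Or.inl (hag g hgj), Or.inr (nodeOutcome hU hZ hP hm hm0 hr hlt hray), Or.inr ?_⟩
    intro e; rw [e] at hlt; exact lt_irrefl _ hlt
  · have ha' : a = k := ha.elim id fun h' => absurd h'.1 (not_isApex_of_snd_ne hgc)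
    subst ha'
    refine ⟨P, hP, hag2, Or.inr (topOutcome hU hZ hP hgc hk hk0 (fin4_ne_add_two _) hlt1 hray1), Or.inr (nodeOutcome hU hZ hP hm hm0 (dirOK_ne_add_two hb) hlt2 hray2),
      Or.inl ?_⟩
    intro e; rw [e] at hlt1; exact lt_irrefl _ hlt1

/-- **EDGE (nn) in OUTCOME FORM** (KERNEL, law-free, every `h`): RULE D at (node of `g`, node of `j`), `g ≠ j`, node levels different, below an
`N`-cell `Z` is served by some `P ∈ C.upper` agreeing with `Z` off `{g, j}` whose `g`- and `j`-letters are `Z`'s or drops of them, not both `Z`'s. -/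
theorem edge_nn_outcomes {h : ℤ} {C : MConfig} (hU : C.InDiamond h) {Z : MCell} (hZ : Z ∈ C.lower) (hD : RuleDMu4N C Z) {g j : Fin 4}
    (hgj : g ≠ j) (hne : nodeLevel (Z g) ≠ nodeLevel (Z j)) :
    ∃ P ∈ C.upper, MAgree2 P Z g j ∧ (P g = Z g ∨ DropOf (Z g) (P g)) ∧ (P j = Z j ∨ DropOf (Z j) (P j)) ∧ (P g ≠ Z g ∨ P j ≠ Z j) := by
  obtain ⟨k, hk, hk0⟩ := exists_node_dir (hU.1 Z hZ g).1
  obtain ⟨m, hm, hm0⟩ := exists_node_dir (hU.1 Z hZ j).1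
  have hne' : coord (Z g) k ≠ coord (Z j) m := by rw [hk0, hm0]; unfold nodeLevel at hne; exact hne
  rcases hD g j hgj k m hk hm hne' with ⟨r, hr, P, hP, hag, hlt, hray⟩ | ⟨r, hr, P, hP, hag, hlt, hray⟩ |
      ⟨a, b, ha, hb, P, hP, hag2, hlt1, hray1, hlt2, hray2⟩
  · refine ⟨P, hP, fun f hf _ => hag f hf, Or.inr (nodeOutcome hU hZ hP hk hk0 hr hlt hray), Or.inl (hag j hgj.symm), Or.inl ?_⟩
    intro e; rw [e] at hlt; exact lt_irrefl _ hlt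
  · refine ⟨P, hP, fun f _ hf => hag f hf, Or.inl (hag g hgj), Or.inr (nodeOutcome hU hZ hP hm hm0 hr hlt hray), Or.inr ?_⟩
    intro e; rw [e] at hlt; exact lt_irrefl _ hlt
  · refine ⟨P, hP, hag2, Or.inr (nodeOutcome hU hZ hP hk hk0 (dirOK_ne_add_two ha) hlt1 hray1),
      Or.inr (nodeOutcome hU hZ hP hm hm0 (dirOK_ne_add_two hb) hlt2 hray2), Or.inl ?_⟩
    intro e; rw [e] at hlt1; exact lt_irrefl _ hlt1

/-! ## §3 The pairwise spread and its arithmetic -/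

/-- the total pairwise spread of four integers. -/
def spreadOf (v : Fin 4 → ℤ) : ℤ := |v 0 - v 1| + |v 0 - v 2| + |v 0 - v 3| + |v 1 - v 2| + |v 1 - v 3| + |v 2 - v 3|

/-- **Ψ, the PAIRWISE SPREAD** of a cell: node spread plus top spread. -/
def pairSpread (Z : MCell) : ℤ := spreadOf (fun f => nodeLevel (Z f)) + spreadOf (fun f => causalTop (Z f))

theorem spreadOf_nonneg (v : Fin 4 → ℤ) : 0 ≤ spreadOf v := by
  unfold spreadOf; positivity

/-- four values in `[0, h]` have spread `≤ 4h` (attained by `0, 0, h, h`). -/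
theorem spreadOf_le {v : Fin 4 → ℤ} {h : ℤ} (h0 : ∀ f, 0 ≤ v f) (hh : ∀ f, v f ≤ h) : spreadOf v ≤ 4 * h := by
  have a0 := h0 0; have a1 := h0 1; have a2 := h0 2; have a3 := h0 3; have b0 := hh 0; have b1 := hh 1; have b2 := hh 2; have b3 := hh 3
  unfold spreadOf; simp only [abs_eq_max_neg, max_def]; split_ifs <;> omega

/-- lowering `a` to `b ≤ a` changes `|a − c|` by at most `a − b` … -/
theorem absPair_lower_le (a b c : ℤ) (hba : b ≤ a) : |a - c| ≤ |b - c| + (a - b) := by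
  rcases le_total 0 (a - c) with h1 | h1 <;> rcases le_total 0 (b - c) with h2 | h2 <;>
    simp only [abs_of_nonneg, abs_of_nonpos, h1, h2] <;> omega

theorem absPair_lower_le' (a b c : ℤ) (hba : b ≤ a) : |c - a| ≤ |c - b| + (a - b) := by
  rw [abs_sub_comm c a, abs_sub_comm c b]; exact absPair_lower_le a b c hba

/-- … and raises it by exactly `a − b` when `c ≥ a`. -/
theorem absPair_lower_min (a b c : ℤ) (hba : b ≤ a) (hac : a ≤ c) : |b - c| = |a - c| + (a - b) := by
  rw [abs_of_nonpos (by omega : b - c ≤ 0), abs_of_nonpos (by omega : a - c ≤ 0)]; ring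

theorem absPair_lower_min' (a b c : ℤ) (hba : b ≤ a) (hac : a ≤ c) : |c - b| = |c - a| + (a - b) := by
  rw [abs_sub_comm c b, abs_sub_comm c a]; exact absPair_lower_min a b c hba hac

/-- lowering ANY entry by `δ ≥ 0` costs at most `3δ` of spread. -/
theorem spreadOf_lower_any {v w : Fin 4 → ℤ} {y : Fin 4} (hw : ∀ g, g ≠ y → w g = v g) (hy : w y ≤ v y) :
    spreadOf v ≤ spreadOf w + 3 * (v y - w y) := by
  fin_cases y <;> simp only [spreadOf, Fin.zero_eta, Fin.mk_one, Fin.isValue, Fin.reduceFinMk, ne_eq] at *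
  · have e1 := hw 1 (by decide); have e2 := hw 2 (by decide); have e3 := hw 3 (by decide)
    have t0 := absPair_lower_le (v 0) (w 0) (v 1) hy; have t1 := absPair_lower_le (v 0) (w 0) (v 2) hy; have t2 := absPair_lower_le (v 0) (w 0) (v 3) hy
    rw [e1, e2, e3]; omega
  · have e1 := hw 0 (by decide); have e2 := hw 2 (by decide); have e3 := hw 3 (by decide)
    have t0 := absPair_lower_le' (v 1) (w 1) (v 0) hy; have t3 := absPair_lower_le (v 1) (w 1) (v 2) hy; have t4 := absPair_lower_le (v 1) (w 1) (v 3) hy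
    rw [e1, e2, e3]; omega
  · have e1 := hw 0 (by decide); have e2 := hw 1 (by decide); have e3 := hw 3 (by decide)
    have t1 := absPair_lower_le' (v 2) (w 2) (v 0) hy; have t3 := absPair_lower_le' (v 2) (w 2) (v 1) hy; have t5 := absPair_lower_le (v 2) (w 2) (v 3) hy
    rw [e1, e2, e3]; omega
  · have e1 := hw 0 (by decide); have e2 := hw 1 (by decide); have e3 := hw 2 (by decide)
    have t2 := absPair_lower_le' (v 3) (w 3) (v 0) hy; have t4 := absPair_lower_le' (v 3) (w 3) (v 1) hy; have t5 := absPair_lower_le' (v 3) (w 3) (v 2) hy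
    rw [e1, e2, e3]; omega

/-- lowering a MINIMAL entry by `δ ≥ 0` raises the spread by exactly `3δ`. -/
theorem spreadOf_lower_min {v w : Fin 4 → ℤ} {y : Fin 4} (hmin : ∀ g, v y ≤ v g) (hw : ∀ g, g ≠ y → w g = v g) (hy : w y ≤ v y) :
    spreadOf w = spreadOf v + 3 * (v y - w y) := by
  fin_cases y <;> simp only [spreadOf, Fin.zero_eta, Fin.mk_one, Fin.isValue, Fin.reduceFinMk, ne_eq] at *
  · have e1 := hw 1 (by decide); have e2 := hw 2 (by decide); have e3 := hw 3 (by decide)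
    have t0 := absPair_lower_min (v 0) (w 0) (v 1) hy (hmin 1); have t1 := absPair_lower_min (v 0) (w 0) (v 2) hy (hmin 2); have t2 := absPair_lower_min (v 0) (w 0) (v 3) hy (hmin 3)
    rw [e1, e2, e3]; omega
  · have e1 := hw 0 (by decide); have e2 := hw 2 (by decide); have e3 := hw 3 (by decide)
    have t0 := absPair_lower_min' (v 1) (w 1) (v 0) hy (hmin 0); have t3 := absPair_lower_min (v 1) (w 1) (v 2) hy (hmin 2); have t4 := absPair_lower_min (v 1) (w 1) (v 3) hy (hmin 3)
    rw [e1, e2, e3]; omega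
  · have e1 := hw 0 (by decide); have e2 := hw 1 (by decide); have e3 := hw 3 (by decide)
    have t1 := absPair_lower_min' (v 2) (w 2) (v 0) hy (hmin 0); have t3 := absPair_lower_min' (v 2) (w 2) (v 1) hy (hmin 1); have t5 := absPair_lower_min (v 2) (w 2) (v 3) hy (hmin 3)
    rw [e1, e2, e3]; omega
  · have e1 := hw 0 (by decide); have e2 := hw 1 (by decide); have e3 := hw 2 (by decide)
    have t2 := absPair_lower_min' (v 3) (w 3) (v 0) hy (hmin 0); have t4 := absPair_lower_min' (v 3) (w 3) (v 1) hy (hmin 1); have t5 := absPair_lower_min' (v 3) (w 3) (v 2) hy (hmin 2)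
    rw [e1, e2, e3]; omega


theorem pairSpread_nonneg (Z : MCell) : 0 ≤ pairSpread Z := by
  unfold pairSpread; have := spreadOf_nonneg (fun f => nodeLevel (Z f)); have := spreadOf_nonneg (fun f => causalTop (Z f)); omega

theorem pairSpread_le {h : ℤ} {Z : MCell} (hZ : MCell.InDiamond h Z) : pairSpread Z ≤ 8 * h := by
  have hn : ∀ f, 0 ≤ nodeLevel (Z f) ∧ nodeLevel (Z f) ≤ h ∧ 0 ≤ causalTop (Z f) ∧ causalTop (Z f) ≤ h := fun f => by
    have h1 := (hZ f).2.1; have h2 := (hZ f).2.2.2; have h3 := absCharge_nonneg (Z f)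
    unfold nodeLevel causalTop; omega
  unfold pairSpread
  have := spreadOf_le (v := fun f => nodeLevel (Z f)) (fun f => (hn f).1) (fun f => (hn f).2.1)
  have := spreadOf_le (v := fun f => causalTop (Z f)) (fun f => (hn f).2.2.1) (fun f => (hn f).2.2.2)
  omega

theorem two_mul_absCharge (x : BPoint) : 2 * absCharge x = causalTop x - nodeLevel x := by
  unfold causalTop nodeLevel; ring


/-- a four-charged cell: every letter charged. -/
def FourCharged (Z : MCell) : Prop := ∀ f, (Z f).2 ≠ (0, 0)

/-- the SHAPE CLASS `K_N` of `N`-cells the kernel declares absent (`ChargeInduction` v11: phase 1 + (CD-N) + the `N` seeds):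
`≥ 2` charged letters and not level, or level with a charged letter of node level `< 2·(count)`. -/
def KN (Z : MCell) : Prop :=
  (2 ≤ chargeCount Z ∧ ¬ LevelCell Z) ∨ (LevelCell Z ∧ ∃ f, (Z f).2 ≠ (0, 0) ∧ nodeLevel (Z f) < 2 * (chargeCount Z : ℤ))

/-- the SHAPE CLASS `K_P` of `P`-cells the kernel declares absent: `≥ 3` charged and not level, or `2` charged, not level and not HIGH (a charged
letter of node `< 4`), or level with a charged letter of node `< 2·(count) − 2` ((CD-P)). -/
def KP (P : MCell) : Prop :=
  (3 ≤ chargeCount P ∧ ¬ LevelCell P) ∨ (chargeCount P = 2 ∧ ¬ LevelCell P ∧ ∃ f, (P f).2 ≠ (0, 0) ∧ nodeLevel (P f) < 4) ∨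
    (LevelCell P ∧ ∃ f, (P f).2 ≠ (0, 0) ∧ nodeLevel (P f) < 2 * (chargeCount P : ℤ) - 2)


/-- a real `P`-cell with EXACTLY ONE apex, the apex lying strictly below the causal top of every (charged) other letter — the only apex-bearing
`P`-cells the Φ∕Θ-peel of an `N`-head ever produces (a descended minimum reaching its node; §9g). -/
def LowApexP (P : MCell) : Prop := ∃ f, (P f).2 = (0, 0) ∧ ∀ g, g ≠ f → (P g).2 ≠ (0, 0) ∧ nodeLevel (P f) < causalTop (P g)

/-- a real `N`-cell with EXACTLY ONE apex, the apex lying strictly above the node of every (charged) other letter — the only apex-bearing `N`-cells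
the peel of a `P`-head ever produces (a lifted maximum reaching its top; §9g). -/
def HighApexN (Z : MCell) : Prop := ∃ f, (Z f).2 = (0, 0) ∧ ∀ g, g ≠ f → (Z g).2 ≠ (0, 0) ∧ nodeLevel (Z g) < causalTop (Z f)

/-- (A₃ᴵ) the INTERFACE of the peel is absent: no high-one-apex `N`-cell of `K_N`, no low-one-apex `P`-cell of `K_P` (§9g: this — not all of (A₃) —
is what the four-charged peel consumes; implied by (A₃), `interfaceKAbsent_of_apexBearingKAbsent`). -/
def InterfaceKAbsent (C : MConfig) : Prop :=
  (∀ Z ∈ C.lower, KN Z → HighApexN Z → False) ∧ (∀ P ∈ C.upper, KP P → LowApexP P → False)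


/-- the four-charged `K`-cells are absent. -/
def FourChargedKAbsent (C : MConfig) : Prop :=
  (∀ Z ∈ C.lower, KN Z → FourCharged Z → False) ∧ (∀ P ∈ C.upper, KP P → FourCharged P → False)


theorem chargeCount_eq_four {Z : MCell} (hall : ∀ f, (Z f).2 ≠ (0, 0)) : chargeCount Z = 4 := by
  unfold chargeCount
  rw [Finset.filter_true_of_mem (fun f _ => hall f)]
  simp

/-- tops decide levelness: cells with the same causal tops slotwise are level together. -/
theorem levelCell_iff_of_tops {P Z : MCell} (ht : ∀ f, causalTop (P f) = causalTop (Z f)) : LevelCell P ↔ LevelCell Z := by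
  unfold LevelCell
  constructor
  · intro hl f g; rw [← ht f, ← ht g]; exact hl f g
  · intro hl f g; rw [ht f, ht g]; exact hl f g



set_option linter.unusedSimpArgs false in
theorem absCharge_dualPt (h : ℤ) (x : BPoint) : absCharge (dualPt h x) = absCharge x := by
  obtain ⟨a, b₁, b₂⟩ := x
  simp only [absCharge, chargeOf, dualPt]
  rw [show -b₁ - -b₂ = -(b₁ - b₂) by ring, abs_neg]

set_option linter.unusedSimpArgs false in
theorem causalTop_dualPt (h : ℤ) (x : BPoint) : causalTop (dualPt h x) = h - nodeLevel x := by
  unfold causalTop nodeLevel; rw [absCharge_dualPt]; simp only [dualPt]; ring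

set_option linter.unusedSimpArgs false in
theorem nodeLevel_dualPt (h : ℤ) (x : BPoint) : nodeLevel (dualPt h x) = h - causalTop x := by
  unfold causalTop nodeLevel; rw [absCharge_dualPt]; simp only [dualPt]; ring

set_option linter.unusedSimpArgs false in
theorem snd_dualPt_ne {h : ℤ} {x : BPoint} (hx : x.2 ≠ (0, 0)) : (dualPt h x).2 ≠ (0, 0) := by
  obtain ⟨a, b₁, b₂⟩ := x
  simp only [dualPt, ne_eq, Prod.mk.injEq, neg_eq_zero] at hx ⊢
  exact hx

set_option linter.unusedSimpArgs false in
/-- the dual of a `◇_h` letter is a `◇_h` letter (`h` even). -/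
theorem inDiamond_dualPt {h : ℤ} (hh : h % 2 = 0) {x : BPoint} (hx : InDiamond h x) : InDiamond h (dualPt h x) := by
  obtain ⟨a, b₁, b₂⟩ := x
  have hq : absCharge (dualPt h (a, b₁, b₂)) = absCharge (a, b₁, b₂) := absCharge_dualPt h _
  obtain ⟨hax, h1, h2, h3⟩ := hx
  refine ⟨?_, ?_, ?_, ?_⟩
  · rcases hax with h0 | hA
    · left; simp only [Prod.mk.injEq] at h0; simp [dualPt, h0.1, h0.2]
    · right; simp only [AxisPt, dualPt, ne_eq, neg_eq_zero] at hA ⊢; exact hA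
  · rw [hq]; simp only [dualPt]; simp only at h3; omega
  · rw [hq]; simp only [dualPt]; simp only at h1 h2 h3; omega
  · rw [hq]; simp only [dualPt]; simp only at h1; omega

/-- the dual of a `◇_h` configuration is a `◇_h` configuration (`h` even). -/
theorem inDiamond_dual {h : ℤ} (hh : h % 2 = 0) {C : MConfig} (hU : C.InDiamond h) : (C.dual h).InDiamond h := by
  refine ⟨fun Z hZ f => ?_, fun P hP f => ?_⟩
  · have hP := mem_dual_lower.1 hZ
    have := inDiamond_dualPt hh (hU.2 _ hP f)
    simpa [dualCell, dualPt_dualPt] using this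
  · have hZ := mem_dual_upper.1 hP
    have := inDiamond_dualPt hh (hU.1 _ hZ f)
    simpa [dualCell, dualPt_dualPt] using this

/-- `n` is a TOP RAISE of `x`: charged, same node level, strictly higher causal top (the dual of a drop). -/
def RaiseOf (x n : BPoint) : Prop := n.2 ≠ (0, 0) ∧ nodeLevel n = nodeLevel x ∧ causalTop x < causalTop n

set_option linter.unusedSimpArgs false in
theorem raiseOf_of_dropOf_dual {h : ℤ} {x n : BPoint} (hd : DropOf (dualPt h x) (dualPt h n)) : RaiseOf x n := by
  obtain ⟨hc, ht, hn⟩ := hd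
  rw [causalTop_dualPt, causalTop_dualPt] at ht
  rw [nodeLevel_dualPt, nodeLevel_dualPt] at hn
  refine ⟨fun h0 => hc ?_, by omega, by omega⟩
  simp only [dualPt, h0, Prod.mk.injEq, neg_zero, and_self]

/-- **EDGE (tt) ABOVE in OUTCOME FORM** (KERNEL, `h` even, law-free): RULE D above a `P`-cell at (top of `y`, top of `z`), `y ≠ z`, tops different, is
served by some `N ∈ C.lower` agreeing with `P` off `{y, z}` whose `y`- and `z`-letters are `P`'s or top raises of them, not both `P`'s.
(`edge_nn_outcomes` in `C.dual h`.) -/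
theorem edge_tt_outcomes_P {h : ℤ} (hh : h % 2 = 0) {C : MConfig} (hU : C.InDiamond h) {P : MCell} (hP : P ∈ C.upper) (hD : RuleDMu4P C P)
    {y z : Fin 4} (hyz : y ≠ z) (hne : causalTop (P y) ≠ causalTop (P z)) :
    ∃ N ∈ C.lower, MAgree2 N P y z ∧ (N y = P y ∨ RaiseOf (P y) (N y)) ∧ (N z = P z ∨ RaiseOf (P z) (N z)) ∧ (N y ≠ P y ∨ N z ≠ P z) := by
  have hU' := inDiamond_dual hh hU
  have hZ' : dualCell h P ∈ (C.dual h).lower := dualCell_mem_dual_lower hP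
  have hD' : RuleDMu4N (C.dual h) (dualCell h P) := (ruleDMu4P_dual h C P).2 hD
  have hne' : nodeLevel (dualCell h P y) ≠ nodeLevel (dualCell h P z) := by
    show nodeLevel (dualPt h (P y)) ≠ nodeLevel (dualPt h (P z)); rw [nodeLevel_dualPt, nodeLevel_dualPt]; omega
  obtain ⟨P', hP', hag, hoy, hoz, hmv⟩ := edge_nn_outcomes hU' hZ' hD' hyz hne'
  have hN : dualCell h P' ∈ C.lower := mem_dual_upper.1 hP'
  have hback : ∀ f, P' f = dualPt h (dualCell h P' f) := fun f => by simp [dualCell, dualPt_dualPt]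
  have hPf : ∀ f, dualCell h P f = dualPt h (P f) := fun f => rfl
  refine ⟨dualCell h P', hN, fun f hf1 hf2 => ?_, ?_, ?_, ?_⟩
  · show dualPt h (P' f) = P f; rw [hag f hf1 hf2, hPf, dualPt_dualPt]
  · rcases hoy with e | hd
    · left; show dualPt h (P' y) = P y; rw [e, hPf, dualPt_dualPt]
    · right; rw [hback y, hPf] at hd; exact raiseOf_of_dropOf_dual hd
  · rcases hoz with e | hd
    · left; show dualPt h (P' z) = P z; rw [e, hPf, dualPt_dualPt]
    · right; rw [hback z, hPf] at hd; exact raiseOf_of_dropOf_dual hd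
  · rcases hmv with hn | hn
    · left; intro e; apply hn; rw [hback y, hPf]; exact congrArg (dualPt h) e
    · right; intro e; apply hn; rw [hback z, hPf]; exact congrArg (dualPt h) e

/-- spread is invariant under negation of all entries … -/
theorem spreadOf_neg (v : Fin 4 → ℤ) : spreadOf (fun f => -v f) = spreadOf v := by
  simp only [spreadOf]
  rw [show -v 0 - -v 1 = -(v 0 - v 1) by ring, show -v 0 - -v 2 = -(v 0 - v 2) by ring, show -v 0 - -v 3 = -(v 0 - v 3) by ring,
    show -v 1 - -v 2 = -(v 1 - v 2) by ring, show -v 1 - -v 3 = -(v 1 - v 3) by ring, show -v 2 - -v 3 = -(v 2 - v 3) by ring]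
  simp only [abs_neg]

/-- … so raising a MAXIMAL entry by `δ ≥ 0` raises the spread by exactly `3δ` … -/
theorem spreadOf_raise_max {v w : Fin 4 → ℤ} {y : Fin 4} (hmax : ∀ g, v g ≤ v y) (hw : ∀ g, g ≠ y → w g = v g) (hy : v y ≤ w y) :
    spreadOf w = spreadOf v + 3 * (w y - v y) := by
  have := spreadOf_lower_min (v := fun f => -v f) (w := fun f => -w f) (y := y) (fun g => by simpa using hmax g)
    (fun g hg => by simp [hw g hg]) (by simpa using hy)
  rw [spreadOf_neg, spreadOf_neg] at this; omega


theorem chargeCount_ge_three {P : MCell} {x : Fin 4} (h : ∀ f, f ≠ x → (P f).2 ≠ (0, 0)) : 3 ≤ chargeCount P := by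
  unfold chargeCount
  calc 3 = (Finset.univ.erase x).card := by rw [Finset.card_erase_of_mem (Finset.mem_univ x)]; simp
    _ ≤ _ := Finset.card_le_card fun f hf => by
        rw [Finset.mem_erase] at hf
        rw [Finset.mem_filter]; exact ⟨Finset.mem_univ f, h f hf.1⟩

/-- a third index. -/
theorem exists_third (x y : Fin 4) : ∃ g : Fin 4, g ≠ x ∧ g ≠ y := by
  by_cases h0 : (0 : Fin 4) ≠ x ∧ (0 : Fin 4) ≠ y
  · exact ⟨0, h0⟩
  by_cases h1 : (1 : Fin 4) ≠ x ∧ (1 : Fin 4) ≠ y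
  · exact ⟨1, h1⟩
  · refine ⟨2, ?_, ?_⟩ <;> omega


theorem exists_min4 (v : Fin 4 → ℤ) : ∃ y, ∀ g, v y ≤ v g := by
  obtain ⟨y, -, hy⟩ := Finset.exists_min_image Finset.univ v Finset.univ_nonempty
  exact ⟨y, fun g => hy g (Finset.mem_univ g)⟩

theorem exists_min_ne (v : Fin 4 → ℤ) (y : Fin 4) : ∃ z, z ≠ y ∧ ∀ g, g ≠ y → v z ≤ v g := by
  have h1 : y + 1 ≠ y := by revert y; decide
  obtain ⟨z, hz, hmin⟩ := Finset.exists_min_image (Finset.univ.erase y) v ⟨y + 1, Finset.mem_erase.2 ⟨h1, Finset.mem_univ _⟩⟩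
  exact ⟨z, (Finset.mem_erase.1 hz).1, fun g hg => hmin g (Finset.mem_erase.2 ⟨hg, Finset.mem_univ _⟩)⟩


theorem exists_max4 (v : Fin 4 → ℤ) : ∃ y, ∀ g, v g ≤ v y := by
  obtain ⟨y, -, hy⟩ := Finset.exists_max_image Finset.univ v Finset.univ_nonempty
  exact ⟨y, fun g => hy g (Finset.mem_univ g)⟩

theorem exists_max_ne (v : Fin 4 → ℤ) (y : Fin 4) : ∃ z, z ≠ y ∧ ∀ g, g ≠ y → v g ≤ v z := by
  have h1 : y + 1 ≠ y := by revert y; decide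
  obtain ⟨z, hz, hmax⟩ := Finset.exists_max_image (Finset.univ.erase y) v ⟨y + 1, Finset.mem_erase.2 ⟨h1, Finset.mem_univ _⟩⟩
  exact ⟨z, (Finset.mem_erase.1 hz).1, fun g hg => hmax g (Finset.mem_erase.2 ⟨hg, Finset.mem_univ _⟩)⟩


theorem causalTop_eq_nodeLevel_of_apex {x : BPoint} (hx : x.2 = (0, 0)) : causalTop x = nodeLevel x := by
  rw [causalTop_eq, absCharge_of_uncharged hx]; ring


/-- (F1) a NODE-FLAT one-apex cell: one apex letter, the three others charged with node EQUAL to the apex level. -/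
def FlatApexN (Z : MCell) : Prop := ∃ f, (Z f).2 = (0, 0) ∧ ∀ g, g ≠ f → (Z g).2 ≠ (0, 0) ∧ nodeLevel (Z g) = nodeLevel (Z f)

/-- (F1) no node-flat one-apex `K_N`-cell. -/
def F1Absent (C : MConfig) : Prop := ∀ Z ∈ C.lower, KN Z → FlatApexN Z → False


theorem node_lt_top_lower {h : ℤ} {C : MConfig} (hU : C.InDiamond h) {Z : MCell} (hZ : Z ∈ C.lower) {g : Fin 4} (hgc : (Z g).2 ≠ (0, 0)) :
    nodeLevel (Z g) < causalTop (Z g) := by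
  have := two_mul_absCharge (Z g)
  have := absCharge_pos_of_not_isApex (hU.1 Z hZ g).1 (not_isApex_of_snd_ne hgc)
  omega

theorem node_lt_top_upper {h : ℤ} {C : MConfig} (hU : C.InDiamond h) {P : MCell} (hP : P ∈ C.upper) {g : Fin 4} (hgc : (P g).2 ≠ (0, 0)) :
    nodeLevel (P g) < causalTop (P g) := by
  have := two_mul_absCharge (P g)
  have := absCharge_pos_of_not_isApex (hU.2 P hP g).1 (not_isApex_of_snd_ne hgc)
  omega

/-! ### restated from `ChargeInduction` (v11) -/

/-- for a μ₄ letter the encoder's `cabs` is `|c|`. -/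
theorem cabs_eq_absCharge {x : BPoint} (hxax : x.2 = (0, 0) ∨ AxisPt x) : cabs x = absCharge x := by
  obtain ⟨a, b, c⟩ := x
  simp only [cabs, absCharge, chargeOf, AxisPt, Prod.mk.injEq] at *
  rcases hxax with ⟨rfl, rfl⟩ | ⟨-, rfl⟩ | ⟨rfl, -⟩ <;> simp

/-- an uncharged letter from `|c| = 0`. -/
theorem snd_eq_zero_of_absCharge {x : BPoint} (hxax : x.2 = (0, 0) ∨ AxisPt x) (h0 : absCharge x = 0) : x.2 = (0, 0) := by
  obtain ⟨a, b, c⟩ := x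
  simp only [absCharge, chargeOf, AxisPt, Prod.mk.injEq] at *
  rcases hxax with ⟨rfl, rfl⟩ | ⟨hb, rfl⟩ | ⟨rfl, hc⟩ <;> simp_all

/-- the TOP direction of a charged letter of non-negative node level is its encoder direction. -/
theorem encDir_of_top_dir {x : BPoint} {k : Fin 4} (hxax : x.2 = (0, 0) ∨ AxisPt x) (hc : x.2 ≠ (0, 0)) (hx0 : absCharge x ≤ x.1)
    (hk : Adapted x k) (hk0 : coord x k = x.1 + absCharge x) : EncDir x k := by
  left
  refine ⟨by have := absCharge_nonneg x; omega, ?_⟩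
  rw [cabs_eq_absCharge hxax]
  obtain ⟨a, b, c⟩ := x
  simp only [coord, Adapted, absCharge, chargeOf, AxisPt, ray, Prod.mk.injEq, ne_eq] at *
  fin_cases k <;> simp at hk hk0 hxax hc ⊢ <;> (simp only [abs_eq_max_neg, max_def] at *; split_ifs at * <;> omega)


/-! ## §1 Letters around an apex point `aI = (a, 0, 0)` -/

/-- an apex letter is `(α, 0, 0)` with node level and causal top `α`. -/
theorem apex_data {x : BPoint} (hx : x.2 = (0, 0)) : x = (x.1, 0, 0) ∧ nodeLevel x = x.1 ∧ causalTop x = x.1 := by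
  refine ⟨eq_of_isApex ((isApex_iff_snd _).2 hx), ?_, ?_⟩
  · unfold nodeLevel; rw [absCharge_of_uncharged hx]; ring
  · unfold causalTop; rw [absCharge_of_uncharged hx]; ring

/-- a μ₄ letter null-BELOW an apex point `aI` (`NullBelow y aI`) is charged with causal top `a`. -/
theorem nullBelow_apexPt {a : ℤ} {y : BPoint} (hyax : y.2 = (0, 0) ∨ AxisPt y) (hnb : NullBelow y (a, 0, 0)) :
    y.2 ≠ (0, 0) ∧ causalTop y = a := by
  obtain ⟨α, b, c⟩ := y
  obtain ⟨hlt, hsq⟩ := hnb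
  simp only at hlt hsq
  unfold causalTop; simp only [absCharge, chargeOf, AxisPt, ne_eq, Prod.mk.injEq] at *
  rcases hyax with ⟨hb, hc⟩ | ⟨hb, hc⟩ | ⟨hb, hc⟩
  · subst hb; subst hc; exfalso; nlinarith
  · subst hc
    have h1 : b ^ 2 = (a - α) ^ 2 := by nlinarith
    have h2 : |b| = |a - α| := (sq_eq_sq_iff_abs_eq_abs b (a - α)).1 h1
    rw [abs_of_pos (by omega : 0 < a - α)] at h2
    refine ⟨fun h => hb h.1, ?_⟩
    rw [sub_zero, h2]; ring
  · subst hb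
    have h1 : c ^ 2 = (a - α) ^ 2 := by nlinarith
    have h2 : |c| = |a - α| := (sq_eq_sq_iff_abs_eq_abs c (a - α)).1 h1
    rw [abs_of_pos (by omega : 0 < a - α)] at h2
    refine ⟨fun h => hc h.2, ?_⟩
    rw [zero_sub, abs_neg, h2]; ring

/-- an apex point `a'I` null-below a CHARGED μ₄ letter `x` sits at the node level of `x`. -/
theorem apexPt_nullBelow_letter {a' : ℤ} {x : BPoint} (hxax : x.2 = (0, 0) ∨ AxisPt x) (hc : x.2 ≠ (0, 0)) (hnb : NullBelow (a', 0, 0) x) :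
    a' = nodeLevel x := by
  obtain ⟨α, b, c⟩ := x
  obtain ⟨hlt, hsq⟩ := hnb
  simp only at hlt hsq
  unfold nodeLevel; simp only [absCharge, chargeOf, AxisPt, ne_eq, Prod.mk.injEq] at *
  rcases hxax with ⟨hb, hc'⟩ | ⟨hb, hc'⟩ | ⟨hb, hc'⟩
  · exact (hc ⟨hb, hc'⟩).elim
  · subst hc'
    have h1 : b ^ 2 = (α - a') ^ 2 := by nlinarith
    have h2 : |b| = |α - a'| := (sq_eq_sq_iff_abs_eq_abs b (α - a')).1 h1
    rw [abs_of_pos (by omega : 0 < α - a')] at h2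
    rw [sub_zero, h2]; ring
  · subst hb
    have h1 : c ^ 2 = (α - a') ^ 2 := by nlinarith
    have h2 : |c| = |α - a'| := (sq_eq_sq_iff_abs_eq_abs c (α - a')).1 h1
    rw [abs_of_pos (by omega : 0 < α - a')] at h2
    rw [zero_sub, abs_neg, h2]; ring

/-- a μ₄ letter SPACELIKE to an apex point `aI` is charged and straddles it: node `< a <` causal top. -/
theorem spacelike_apexPt {a : ℤ} {y : BPoint} (hyax : y.2 = (0, 0) ∨ AxisPt y) (hsp : Spacelike (bsub y (a, 0, 0))) :
    y.2 ≠ (0, 0) ∧ nodeLevel y < a ∧ a < causalTop y := by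
  obtain ⟨α, b, c⟩ := y
  unfold Spacelike bsub at hsp
  simp only at hsp
  unfold nodeLevel causalTop; simp only [absCharge, chargeOf, AxisPt, ne_eq, Prod.mk.injEq] at *
  rcases hyax with ⟨hb, hc⟩ | ⟨hb, hc⟩ | ⟨hb, hc⟩
  · subst hb; subst hc; exfalso; nlinarith
  · subst hc
    have h1 : (α - a) ^ 2 < b ^ 2 := by nlinarith
    have h2 : |α - a| < |b| := sq_lt_sq.1 h1
    rw [abs_lt] at h2
    refine ⟨fun h => hb h.1, ?_, ?_⟩ <;> (rw [sub_zero]; omega)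
  · subst hb
    have h1 : (α - a) ^ 2 < c ^ 2 := by nlinarith
    have h2 : |α - a| < |c| := sq_lt_sq.1 h1
    rw [abs_lt] at h2
    refine ⟨fun h => hc h.2, ?_, ?_⟩ <;> (rw [zero_sub, abs_neg]; omega)

/-- `j > 0` null steps UP from an apex point in direction `u`: a charged letter of node level `a` and causal top `a + 2j`. -/
theorem ray_up_apexPt {a j : ℤ} (hj : 0 < j) (u : Fin 4) :
    (ray ((a, 0, 0) : BPoint) u j).2 ≠ (0, 0) ∧ nodeLevel (ray ((a, 0, 0) : BPoint) u j) = a ∧ causalTop (ray ((a, 0, 0) : BPoint) u j) = a + 2 * j :=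
  ⟨snd_ne_ray_apex a u (ne_of_gt hj), nodeLevel_ray_apex a u (le_of_lt hj), by unfold causalTop; exact top_ray_apex a u (le_of_lt hj)⟩

/-! ## §2 LOW-TWO one-apex cells and their `N`-step (RULE A keeps the slot pair and the tops) -/

/-- a LOW-TWO one-apex cell with apex slot `f` and low slot `g`: `f` is the only apex, the charged letter `g` has its causal top at or below
the apex level, and the two remaining (charged) letters reach strictly above it (`lowTops = 2` of `PairSpread` §9i, with the low slot named). -/
def LowTwo (X : MCell) (f g : Fin 4) : Prop :=
  g ≠ f ∧ (X f).2 = (0, 0) ∧ (∀ e, e ≠ f → (X e).2 ≠ (0, 0)) ∧ causalTop (X g) ≤ causalTop (X f) ∧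
    ∀ e, e ≠ f → e ≠ g → causalTop (X f) < causalTop (X e)

/-- the low-two `K`-cells are absent (both levels). -/
def LowTwoKAbsent (C : MConfig) : Prop :=
  (∀ Z ∈ C.lower, KN Z → ∀ f g, LowTwo Z f g → False) ∧ (∀ P ∈ C.upper, KP P → ∀ f g, LowTwo P f g → False)

/-- a low-two cell is not level. -/
theorem not_levelCell_of_lowTwo {X : MCell} {f g : Fin 4} (hL : LowTwo X f g) : ¬ LevelCell X := by
  obtain ⟨hgf, -, -, hle, hhi⟩ := hL
  obtain ⟨e, hef, heg⟩ := exists_third f g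
  intro hl; have := hl g e; have := hhi e hef heg; omega

/-- **the `N`-step** (KERNEL, law-free, every `h`): a low-two `N`-cell `Z ∈ C.lower` is absent as soon as the four-charged `K_P`-cells and the
low-two `K_P`-cells WITH THE SAME SLOTS of larger Ψ are.  RULE D at (node of the apex `p`) vs (node of a node-minimal charged letter) is served
(RULE A, `PairSpread` §9c) by a same-tops one-apex `P` with one letter dropped: the minimum dropped ⇒ a low-two `K_P`-cell with the same slot
pair and `Ψ + 3δ`; the apex dropped ⇒ a four-charged non-level `K_P`-cell. -/
theorem lowTwo_N {h : ℤ} {C : MConfig} (hU : C.InDiamond h) {Z : MCell} (hZ : Z ∈ C.lower) (hD : RuleDMu4N C Z) {p g : Fin 4}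
    (hL : LowTwo Z p g) (h4 : ∀ P ∈ C.upper, KP P → FourCharged P → False)
    (hup : ∀ P ∈ C.upper, KP P → LowTwo P p g → pairSpread Z < pairSpread P → False) : False := by
  have hl : ¬ LevelCell Z := not_levelCell_of_lowTwo hL
  obtain ⟨hgp, hp, hch, hgle, hhi⟩ := hL
  have htp : causalTop (Z p) = nodeLevel (Z p) := causalTop_eq_nodeLevel_of_apex hp
  -- RULE A at (node of `p`, node of `j`), `j ≠ p` of different node level: a same-tops `P` with `j` dropped (or `p` dropped ⇒ four-charged, absent)
  have main : ∀ j, j ≠ p → nodeLevel (Z p) ≠ nodeLevel (Z j) →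
      ∃ P ∈ C.upper, KP P ∧ (∀ f, causalTop (P f) = causalTop (Z f)) ∧ (P p).2 = (0, 0) ∧ (∀ e, e ≠ p → (P e).2 ≠ (0, 0)) ∧
        (∀ e, e ≠ j → P e = Z e) ∧ DropOf (Z j) (P j) := by
    intro j hjp hne
    obtain ⟨P, hP, hag, hop, hoj, hmv⟩ := edge_nn_outcomes hU hZ hD hjp.symm hne
    have hT : ∀ f, causalTop (P f) = causalTop (Z f) := fun f => by
      by_cases hfp : f = p
      · subst hfp; exact hop.elim (fun e => by rw [e]) (fun hd => hd.2.1)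
      · by_cases hfj : f = j
        · subst hfj; exact hoj.elim (fun e => by rw [e]) (fun hd => hd.2.1)
        · rw [hag f hfp hfj]
    have hPc : ∀ e, e ≠ p → (P e).2 ≠ (0, 0) := fun e hep => by
      by_cases hej : e = j
      · subst hej; exact hoj.elim (fun e' => by rw [e']; exact hch e hep) (fun hd => hd.1)
      · rw [hag e hep hej]; exact hch e hep
    have hnl : ¬ LevelCell P := fun hl' => hl ((levelCell_iff_of_tops hT).1 hl')
    rcases hop with ep | hdp
    · -- `p` kept: `j` dropped
      have hdj : DropOf (Z j) (P j) := by
        rcases hoj with ej | hd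
        · exact (hmv.elim (fun hn => (hn ep).elim) (fun hn => (hn ej).elim))
        · exact hd
      refine ⟨P, hP, Or.inl ⟨chargeCount_ge_three hPc, hnl⟩, hT, by rw [ep]; exact hp, hPc, fun e hej => ?_, hdj⟩
      by_cases hep : e = p
      · rw [hep, ep]
      · exact hag e hep hej
    · -- `p` dropped: four-charged non-level `K_P`: absent
      exfalso
      have h4P : FourCharged P := fun f => by
        by_cases hfp : f = p
        · rw [hfp]; exact hdp.1
        · exact hPc f hfp
      exact h4 P hP (Or.inl ⟨by rw [chargeCount_eq_four h4P]; norm_num, hnl⟩) h4P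
  -- a node-minimal charged letter lies strictly below the apex (the low letter `g` does: node(g) < top(g) ≤ ℓ)
  obtain ⟨gm, hgmp, hgm⟩ := exists_min_ne (fun f => nodeLevel (Z f)) p
  have hgmmin : ∀ e, e ≠ p → nodeLevel (Z gm) ≤ nodeLevel (Z e) := hgm
  have hA : nodeLevel (Z gm) < nodeLevel (Z p) := by
    have := hgmmin g hgp; have := node_lt_top_lower hU hZ (hch g hgp); omega
  obtain ⟨P, hP, hKP, hT, hPp, hPc, hPe, hdrop⟩ := main gm hgmp (ne_of_gt hA)
  refine hup P hP hKP ⟨hgp, hPp, hPc, by rw [hT g, hT p]; exact hgle, fun e hep heg => by rw [hT p, hT e]; exact hhi e hep heg⟩ ?_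
  -- Ψ(P) = Ψ(Z) + 3δ, δ = node drop of the minimum `gm`
  have hn : ∀ e, e ≠ gm → nodeLevel (P e) = nodeLevel (Z e) := fun e he => by rw [hPe e he]
  have hmin : ∀ e, nodeLevel (Z gm) ≤ nodeLevel (Z e) := fun e => by
    by_cases hep : e = p
    · rw [hep]; exact le_of_lt hA
    · exact hgmmin e hep
  have hδ : nodeLevel (P gm) < nodeLevel (Z gm) := hdrop.2.2
  have hns := spreadOf_lower_min (v := fun f => nodeLevel (Z f)) (w := fun f => nodeLevel (P f)) (y := gm) hmin
    (fun e he => hn e he) (le_of_lt hδ)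
  have hts : spreadOf (fun f => causalTop (P f)) = spreadOf (fun f => causalTop (Z f)) := by
    congr 1; funext f; exact hT f
  unfold pairSpread; rw [hns, hts]; omega

/-! ## §3 The `P`-step for low-two cells (RULE PA: a raise of the top-maximal letter keeps the slot pair) -/

/-- **the `P`-step** (KERNEL, law-free, `h` even): a low-two `P`-cell `P ∈ C.upper` is absent as soon as the four-charged `K_N`-cells and the
low-two `K_N`-cells with the same slots of larger Ψ are.  RULE D above `P` at (top of the apex `p`) vs (top of a top-maximal letter `gM`)
(`PairSpread` §6 `edge_tt_outcomes_P`): `gM` raised ⇒ a low-two `N`-cell with the same slot pair and `Ψ + 3δ`; `p` raised ⇒ four-charged non-level. -/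
theorem lowTwo_P {h : ℤ} (hh : h % 2 = 0) {C : MConfig} (hU : C.InDiamond h) {P : MCell} (hP : P ∈ C.upper) (hD : RuleDMu4P C P)
    {p g : Fin 4} (hL : LowTwo P p g) (h4 : ∀ N ∈ C.lower, KN N → FourCharged N → False)
    (hdn : ∀ N ∈ C.lower, KN N → LowTwo N p g → pairSpread P < pairSpread N → False) : False := by
  obtain ⟨hgp, hp, hch, hgle, hhi⟩ := hL
  have htp : causalTop (P p) = nodeLevel (P p) := causalTop_eq_nodeLevel_of_apex hp
  obtain ⟨gM, hgMp, hgM⟩ := exists_max_ne (fun f => causalTop (P f)) p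
  have hgMmax : ∀ e, e ≠ p → causalTop (P e) ≤ causalTop (P gM) := hgM
  obtain ⟨e3, he3p, he3g⟩ := exists_third p g
  have hPA : causalTop (P p) < causalTop (P gM) := by have := hhi e3 he3p he3g; have := hgMmax e3 he3p; omega
  have hgMg : gM ≠ g := fun e => by rw [e] at hPA; omega
  have hne : causalTop (P p) ≠ causalTop (P gM) := ne_of_lt hPA
  obtain ⟨N, hN, hag, hop, hogM, hmv⟩ := edge_tt_outcomes_P hh hU hP hD hgMp.symm hne
  have hNg : N g = P g := hag g hgp hgMg.symm
  rcases hop with ep | hrp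
  · -- `p` kept (apex), `gM` raised by δ > 0: a low-two `N`-cell with the same slot pair, Ψ + 3δ
    have hrg : RaiseOf (P gM) (N gM) := by
      rcases hogM with e | hr
      · exact (hmv.elim (fun hn => (hn ep).elim) (fun hn => (hn e).elim))
      · exact hr
    have hothers : ∀ e, e ≠ p → (N e).2 ≠ (0, 0) := fun e he => by
      by_cases heM : e = gM
      · rw [heM]; exact hrg.1
      · rw [hag e he heM]; exact hch e he
    have hnn : ∀ f, nodeLevel (N f) = nodeLevel (P f) := fun f => by
      by_cases hfp : f = p; · rw [hfp, ep]
      by_cases hfM : f = gM; · rw [hfM]; exact hrg.2.1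
      rw [hag f hfp hfM]
    have ht : ∀ f, f ≠ gM → causalTop (N f) = causalTop (P f) := fun f hf => by
      by_cases hfp : f = p; · rw [hfp, ep]
      rw [hag f hfp hf]
    have hTe : ∀ e, causalTop (P e) ≤ causalTop (N e) := fun e => by
      by_cases heM : e = gM
      · rw [heM]; exact le_of_lt hrg.2.2
      · rw [ht e heM]
    have hnl : ¬ LevelCell N := fun hl => by
      have := hl g e3; rw [hNg] at this; have := hhi e3 he3p he3g; have := hTe e3; have := hgle; omega
    refine hdn N hN (Or.inl ⟨le_trans (by norm_num) (chargeCount_ge_three hothers), hnl⟩)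
      ⟨hgp, by rw [ep]; exact hp, hothers, by rw [hNg, ep]; exact hgle, fun e hep heg => lt_of_lt_of_le (by rw [ep]; exact hhi e hep heg) (hTe e)⟩ ?_
    have hmax : ∀ f, causalTop (P f) ≤ causalTop (P gM) := fun f => by
      by_cases hfp : f = p
      · rw [hfp]; exact le_of_lt hPA
      · exact hgMmax f hfp
    have := spreadOf_raise_max (v := fun f => causalTop (P f)) (w := fun f => causalTop (N f)) (y := gM) hmax ht (le_of_lt hrg.2.2)
    have hns : spreadOf (fun f => nodeLevel (N f)) = spreadOf (fun f => nodeLevel (P f)) := by congr 1; funext f; exact hnn f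
    have hδ := hrg.2.2
    unfold pairSpread; rw [hns, this]; omega
  · -- `p` raised: `N` is four-charged and non-level (`g` keeps its top `≤ ℓ <` the raised top of `p`)
    have h4N : FourCharged N := fun f => by
      by_cases hfp : f = p; · rw [hfp]; exact hrp.1
      by_cases hfM : f = gM
      · rw [hfM]; exact hogM.elim (fun e => by rw [e]; exact hch gM hgMp) (fun hr => hr.1)
      · rw [hag f hfp hfM]; exact hch f hfp
    have hnl : ¬ LevelCell N := fun hl => by have := hl g p; rw [hNg] at this; have := hrp.2.2; omega
    exact h4 N hN (Or.inl ⟨by rw [chargeCount_eq_four h4N]; norm_num, hnl⟩) h4N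

/-! ## §4 Ψ-induction: the low-two `K`-cells are absent given the four-charged ones -/

/-- one level of the Ψ-induction (both steps). -/
theorem lowTwoStep {h : ℤ} (hh : h % 2 = 0) {C : MConfig} (hU : C.InDiamond h) (hD : RuleDMu4Closed C) (h4 : FourChargedKAbsent C) (k : ℤ)
    (hIH : (∀ Z ∈ C.lower, KN Z → ∀ p g, LowTwo Z p g → k < pairSpread Z → False) ∧
      (∀ P ∈ C.upper, KP P → ∀ p g, LowTwo P p g → k < pairSpread P → False)) :
    (∀ Z ∈ C.lower, KN Z → ∀ p g, LowTwo Z p g → pairSpread Z = k → False) ∧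
      (∀ P ∈ C.upper, KP P → ∀ p g, LowTwo P p g → pairSpread P = k → False) := by
  refine ⟨fun Z hZ _ p g hL he => ?_, fun P hP _ p g hL he => ?_⟩
  · exact lowTwo_N hU hZ (hD.1 Z hZ) hL h4.2 fun P hP hKP hLP hlt => hIH.2 P hP hKP p g hLP (by rw [he] at hlt; exact hlt)
  · exact lowTwo_P hh hU hP (hD.2 P hP) hL h4.1 fun N hN hKN hLN hlt => hIH.1 N hN hKN p g hLN (by rw [he] at hlt; exact hlt)

/-- **the low-two `K`-cells are absent given the four-charged ones** (KERNEL, `h` even, RULE D only). -/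
theorem lowTwoK_absent_of_fourCharged {h : ℤ} (hh : h % 2 = 0) {C : MConfig} (hU : C.InDiamond h) (hD : RuleDMu4Closed C)
    (h4 : FourChargedKAbsent C) : LowTwoKAbsent C := by
  have hbN : ∀ Z ∈ C.lower, pairSpread Z ≤ 8 * h := fun Z hZ => pairSpread_le (hU.1 Z hZ)
  have hbP : ∀ P ∈ C.upper, pairSpread P ≤ 8 * h := fun P hP => pairSpread_le (hU.2 P hP)
  generalize 8 * h = B at hbN hbP
  have key : ∀ n : ℕ, (∀ Z ∈ C.lower, KN Z → ∀ p g, LowTwo Z p g → B - n ≤ pairSpread Z → False) ∧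
      (∀ P ∈ C.upper, KP P → ∀ p g, LowTwo P p g → B - n ≤ pairSpread P → False) := by
    intro n
    induction n with
    | zero =>
      have hab : (∀ Z ∈ C.lower, KN Z → ∀ p g, LowTwo Z p g → B < pairSpread Z → False) ∧
          (∀ P ∈ C.upper, KP P → ∀ p g, LowTwo P p g → B < pairSpread P → False) :=
        ⟨fun Z hZ _ _ _ _ hlt => absurd (hbN Z hZ) (not_le.2 hlt), fun P hP _ _ _ _ hlt => absurd (hbP P hP) (not_le.2 hlt)⟩
      obtain ⟨hN, hP⟩ := lowTwoStep hh hU hD h4 B hab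
      refine ⟨fun Z hZ hK p g hL hle => hN Z hZ hK p g hL ?_, fun P hP' hK p g hL hle => hP P hP' hK p g hL ?_⟩
      · have := hbN Z hZ; push_cast at hle; omega
      · have := hbP P hP'; push_cast at hle; omega
    | succ n ih =>
      have hab : (∀ Z ∈ C.lower, KN Z → ∀ p g, LowTwo Z p g → B - (n + 1) < pairSpread Z → False) ∧
          (∀ P ∈ C.upper, KP P → ∀ p g, LowTwo P p g → B - (n + 1) < pairSpread P → False) :=
        ⟨fun Z hZ hK p g hL hlt => ih.1 Z hZ hK p g hL (by omega), fun P hP hK p g hL hlt => ih.2 P hP hK p g hL (by omega)⟩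
      obtain ⟨hN, hP⟩ := lowTwoStep hh hU hD h4 (B - (n + 1)) hab
      refine ⟨fun Z hZ hK p g hL hle => ?_, fun P hP' hK p g hL hle => ?_⟩
      · by_cases he : pairSpread Z = B - (n + 1)
        · exact hN Z hZ hK p g hL he
        · exact ih.1 Z hZ hK p g hL (by push_cast at hle; omega)
      · by_cases he : pairSpread P = B - (n + 1)
        · exact hP P hP' hK p g hL he
        · exact ih.2 P hP' hK p g hL (by push_cast at hle; omega)
  refine ⟨fun Z hZ hK p g hL => (key B.toNat).1 Z hZ hK p g hL ?_, fun P hP hK p g hL => (key B.toNat).2 P hP hK p g hL ?_⟩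
  · have := pairSpread_nonneg Z; have := Int.self_le_toNat B; omega
  · have := pairSpread_nonneg P; have := Int.self_le_toNat B; omega

/-! ## §5 The node-flat head: its letters, the cells around it, and STEP A -/

/-- the letters of a node-flat one-apex cell: apex `p` at level `ℓ = (Z p).1`, every other letter charged with node level `ℓ` and causal top `> ℓ`. -/
theorem flat_data {h : ℤ} {C : MConfig} (hU : C.InDiamond h) {Z : MCell} (hZ : Z ∈ C.lower) {p : Fin 4} (hp : (Z p).2 = (0, 0))
    (hfl : ∀ g, g ≠ p → (Z g).2 ≠ (0, 0) ∧ nodeLevel (Z g) = nodeLevel (Z p)) :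
    Z p = ((Z p).1, 0, 0) ∧ nodeLevel (Z p) = (Z p).1 ∧ causalTop (Z p) = (Z p).1 ∧
      ∀ g, g ≠ p → (Z g).2 ≠ (0, 0) ∧ nodeLevel (Z g) = (Z p).1 ∧ (Z p).1 < causalTop (Z g) := by
  obtain ⟨he, hn, ht⟩ := apex_data hp
  refine ⟨he, hn, ht, fun g hg => ⟨(hfl g hg).1, by rw [(hfl g hg).2, hn], ?_⟩⟩
  have := node_lt_top_lower hU hZ (hfl g hg).1; rw [(hfl g hg).2, hn] at this; exact this

section Around

variable {h : ℤ} {C : MConfig} {Z : MCell} {p : Fin 4}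

/-- a `P`-cell agreeing with the flat head off one slot `σ ≠ p` whose `σ`-letter is CHARGED with node level `ℓ`: a low-one-apex interface `K_P`-cell. -/
theorem flat_partialDesc_absent (hU : C.InDiamond h) (hlet : ∀ g, g ≠ p → (Z g).2 ≠ (0, 0) ∧ nodeLevel (Z g) = (Z p).1 ∧ (Z p).1 < causalTop (Z g))
    (hp : (Z p).2 = (0, 0)) (hnp : nodeLevel (Z p) = (Z p).1) (hI : InterfaceKAbsent C)
    {P : MCell} (hP : P ∈ C.upper) {σ : Fin 4} (hσp : σ ≠ p) (hag : ∀ g, g ≠ σ → P g = Z g) (hc : (P σ).2 ≠ (0, 0))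
    (hn : nodeLevel (P σ) = (Z p).1) : False := by
  have hPp : P p = Z p := hag p hσp.symm
  have hch : ∀ e, e ≠ p → (P e).2 ≠ (0, 0) := fun e he => by
    by_cases hes : e = σ
    · rw [hes]; exact hc
    · rw [hag e hes]; exact (hlet e he).1
  have htσ : (Z p).1 < causalTop (P σ) := by have := node_lt_top_upper hU hP hc; rw [hn] at this; exact this
  have hlow : ∀ e, e ≠ p → (P e).2 ≠ (0, 0) ∧ nodeLevel (P p) < causalTop (P e) := fun e he => ⟨hch e he, by
    rw [hPp, hnp]; by_cases hes : e = σ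
    · rw [hes]; exact htσ
    · rw [hag e hes]; exact (hlet e he).2.2⟩
  have hnl : ¬ LevelCell P := fun hl => by
    have := hl p σ; rw [hPp, causalTop_eq_nodeLevel_of_apex hp, hnp] at this; omega
  exact hI.2 P hP (Or.inl ⟨chargeCount_ge_three hch, hnl⟩) ⟨p, by rw [hPp]; exact hp, hlow⟩

/-- a `P`-cell agreeing with the flat head off one slot `σ ≠ p` whose `σ`-letter is CHARGED with causal top `ℓ`: a low-two `K_P`-cell (apex `p`, low slot `σ`). -/
theorem flat_topAt_absent (hlet : ∀ g, g ≠ p → (Z g).2 ≠ (0, 0) ∧ nodeLevel (Z g) = (Z p).1 ∧ (Z p).1 < causalTop (Z g))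
    (hp : (Z p).2 = (0, 0)) (htp : causalTop (Z p) = (Z p).1) (hL : ∀ P ∈ C.upper, KP P → ∀ f g, LowTwo P f g → False)
    {P : MCell} (hP : P ∈ C.upper) {σ : Fin 4} (hσp : σ ≠ p) (hag : ∀ g, g ≠ σ → P g = Z g) (hc : (P σ).2 ≠ (0, 0))
    (ht : causalTop (P σ) = (Z p).1) : False := by
  have hPp : P p = Z p := hag p hσp.symm
  have hch : ∀ e, e ≠ p → (P e).2 ≠ (0, 0) := fun e he => by
    by_cases hes : e = σ
    · rw [hes]; exact hc
    · rw [hag e hes]; exact (hlet e he).1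
  obtain ⟨e3, he3σ, he3p⟩ := exists_third σ p
  have h3 : (Z p).1 < causalTop (P e3) := by rw [hag e3 he3σ]; exact (hlet e3 he3p).2.2
  have hnl : ¬ LevelCell P := fun hl => by have := hl σ e3; omega
  refine hL P hP (Or.inl ⟨chargeCount_ge_three hch, hnl⟩) p σ ⟨hσp, by rw [hPp]; exact hp, hch, by rw [ht, hPp, htp], fun e he hes => ?_⟩
  rw [hPp, htp, hag e hes]; exact (hlet e he).2.2

/-- a `P`-cell agreeing with the flat head off `{p, g}` whose `p`-letter is CHARGED with causal top `ℓ` and whose `g`-letter is the apex `ℓI`: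
a low-two `K_P`-cell (apex `g`, low slot `p`). -/
theorem flat_swapAt_absent (hlet : ∀ g, g ≠ p → (Z g).2 ≠ (0, 0) ∧ nodeLevel (Z g) = (Z p).1 ∧ (Z p).1 < causalTop (Z g))
    (hL : ∀ P ∈ C.upper, KP P → ∀ f g, LowTwo P f g → False)
    {P : MCell} (hP : P ∈ C.upper) {g : Fin 4} (hgp : g ≠ p) (hag : ∀ e, e ≠ p → e ≠ g → P e = Z e) (hc : (P p).2 ≠ (0, 0))
    (ht : causalTop (P p) = (Z p).1) (hg : P g = ((Z p).1, 0, 0)) : False := by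
  have hg0 : (P g).2 = (0, 0) := by rw [hg]
  have htg : causalTop (P g) = (Z p).1 := by rw [hg]; unfold causalTop; simp [absCharge, chargeOf]
  have hch : ∀ e, e ≠ g → (P e).2 ≠ (0, 0) := fun e he => by
    by_cases hep : e = p
    · rw [hep]; exact hc
    · rw [hag e hep he]; exact (hlet e hep).1
  obtain ⟨e3, he3p, he3g⟩ := exists_third p g
  have h3 : (Z p).1 < causalTop (P e3) := by rw [hag e3 he3p he3g]; exact (hlet e3 he3p).2.2
  have hnl : ¬ LevelCell P := fun hl => by have := hl g e3; omega
  refine hL P hP (Or.inl ⟨chargeCount_ge_three hch, hnl⟩) g p ⟨hgp.symm, hg0, hch, by rw [ht, htg], fun e heg hep => ?_⟩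
  rw [htg, hag e hep heg]; exact (hlet e hep).2.2

/-- a `P`-cell agreeing with the flat head off `{p, σ}` whose `p`- and `σ`-letters are both CHARGED and which has two different causal tops:
a four-charged non-level `K_P`-cell. -/
theorem flat_fourCharged_absent (hlet : ∀ g, g ≠ p → (Z g).2 ≠ (0, 0) ∧ nodeLevel (Z g) = (Z p).1 ∧ (Z p).1 < causalTop (Z g))
    (h4 : ∀ P ∈ C.upper, KP P → FourCharged P → False)
    {P : MCell} (hP : P ∈ C.upper) {σ : Fin 4} (hag : ∀ e, e ≠ σ → e ≠ p → P e = Z e) (hcp : (P p).2 ≠ (0, 0))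
    (hcσ : (P σ).2 ≠ (0, 0)) {a b : Fin 4} (hne : causalTop (P a) ≠ causalTop (P b)) : False := by
  have h4P : FourCharged P := fun f => by
    by_cases hfp : f = p; · rw [hfp]; exact hcp
    by_cases hfs : f = σ; · rw [hfs]; exact hcσ
    rw [hag f hfs hfp]; exact (hlet f hfp).1
  exact h4 P hP (Or.inl ⟨by rw [chargeCount_eq_four h4P]; norm_num, fun hl => hne (hl a b)⟩) h4P

end Around

/-- **STEP A** (KERNEL, every `h`): below a node-flat one-apex head `Z` with apex slot `p` and a charged slot `σ`, the FULL DESCENT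
`q = Z[σ ↦ ℓI]` is present — RULE D at (apex, any direction) vs (`σ`, top direction) is served (`edge_tn_outcomes`) only by four-charged
non-level cells, interface cells, low-two cells, or `q`. -/
theorem flat_descent_present {h : ℤ} {C : MConfig} (hU : C.InDiamond h) {Z : MCell} (hZ : Z ∈ C.lower) (hD : RuleDMu4N C Z)
    {p σ : Fin 4} (hσp : σ ≠ p) (hp : (Z p).2 = (0, 0)) (hfl : ∀ g, g ≠ p → (Z g).2 ≠ (0, 0) ∧ nodeLevel (Z g) = nodeLevel (Z p))
    (hI : InterfaceKAbsent C) (h4 : ∀ P ∈ C.upper, KP P → FourCharged P → False)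
    (hL : ∀ P ∈ C.upper, KP P → ∀ f g, LowTwo P f g → False) :
    ∃ q ∈ C.upper, MAgree q Z σ ∧ q σ = Z p := by
  obtain ⟨hZp, hnp, htp, hlet⟩ := flat_data hU hZ hp hfl
  obtain ⟨hσc, hσn, hσt⟩ := hlet σ hσp
  have hne : causalTop (Z σ) ≠ nodeLevel (Z p) := by rw [hnp]; exact ne_of_gt hσt
  obtain ⟨P, hP, hag, hoσ, hop, hmv⟩ := edge_tn_outcomes hU hZ hD hσp hσc hne
  obtain ⟨e3, he3σ, he3p⟩ := exists_third σ p
  have hP3 : (Z p).1 < causalTop (P e3) := by rw [hag e3 he3σ he3p]; exact (hlet e3 he3p).2.2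
  rcases hop with ep | hdp
  · -- `p` kept
    have hag1 : ∀ g, g ≠ σ → P g = Z g := fun g hg => by
      by_cases hgp : g = p
      · rw [hgp, ep]
      · exact hag g hg hgp
    rcases hoσ with eσ | hdesc | hover
    · exact (hmv.elim (fun hn => (hn eσ).elim) (fun hn => (hn ep).elim))
    · by_cases hσ0 : (P σ).2 = (0, 0)
      · -- the full descent
        refine ⟨P, hP, hag1, ?_⟩
        obtain ⟨heq, hnn, -⟩ := apex_data hσ0
        have h1 : (P σ).1 = (Z p).1 := by rw [← hnn, hdesc.1, hσn]
        rw [heq, h1, ← hZp]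
      · exact (flat_partialDesc_absent hU hlet hp hnp hI hP hσp hag1 hσ0 (by rw [hdesc.1, hσn])).elim
    · exact (flat_topAt_absent hlet hp htp hL hP hσp hag1 hover.1 (by rw [hover.2.1, hσn])).elim
  · -- `p` dropped: charged of causal top `ℓ`, so `P` is four-charged non-level or (σ fully descended) a swapped low-two cell
    exfalso
    obtain ⟨hpc, hpt, -⟩ := hdp
    rw [htp] at hpt
    by_cases hσ0 : (P σ).2 = (0, 0)
    · have hdesc : DescOf (Z σ) (P σ) := by
        rcases hoσ with eσ | hd | ho
        · exact absurd (by rw [eσ]; exact hσc : (P σ).2 ≠ (0, 0)) (not_not.2 hσ0)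
        · exact hd
        · exact (ho.1 hσ0).elim
      obtain ⟨heq, hnn, -⟩ := apex_data hσ0
      have h1 : (P σ).1 = (Z p).1 := by rw [← hnn, hdesc.1, hσn]
      exact flat_swapAt_absent hlet hL hP hσp (fun e hep hes => hag e hes hep) hpc hpt (by rw [heq, h1])
    · exact flat_fourCharged_absent hlet h4 hP hag hpc hσ0 (a := p) (b := e3) (by rw [hpt]; exact ne_of_lt hP3)

/-! ## §6 STEP B: the A2I⁻ instance fires — the node-flat family is absent -/

/-- **(F1) dies by RULE D + A2I⁻ + S₄ given the interface, the four-charged `K_P`-cells and the low-two `K_P`-cells** (KERNEL, every `h`).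
For a node-flat one-apex head `Z ∈ C.lower` (apex slot `p` at level `ℓ`, charged slot `σ = p + 2` with top direction `u`, `Z σ = ℓI + c·n_u`):
STEP A puts `q = Z[σ ↦ ℓI]` in `C.upper`; `PermClosed` puts `N' = Z ∘ (p σ)` in `C.lower`; and the A2I⁻ instance `(Z; σ, u; q; p, u; N')`
FIRES (`XresA2IFires`): its eleven conjuncts hold because every escaping `P ∈ C.upper` would be four-charged non-level, interface or low-two. -/
theorem flatApex_absent_of_lowTwo {h : ℤ} {C : MConfig} (hU : C.InDiamond h) (hD : RuleDMu4Closed C) (hA : A2IMinusClosed C)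
    (hS : PermClosed C.lower) (hI : InterfaceKAbsent C) (h4 : ∀ P ∈ C.upper, KP P → FourCharged P → False)
    (hL : ∀ P ∈ C.upper, KP P → ∀ f g, LowTwo P f g → False) : F1Absent C := by
  rintro Z hZ - ⟨p, hp, hfl⟩
  obtain ⟨hZp, hnp, htp, hlet⟩ := flat_data hU hZ hp hfl
  -- the charged slot σ = p + 2, its top direction u, charge c > 0 and ray form
  have hσp : p + 2 ≠ p := (fin4_ne_add_two p).symm
  obtain ⟨hσc, hσn, hσt⟩ := hlet (p + 2) hσp
  have hσax := (hU.1 Z hZ (p + 2)).1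
  obtain ⟨u, hu, hu0⟩ := exists_top_dir' hσax
  have hE : EncDir (Z (p + 2)) u := encDir_of_top_dir hσax hσc (hU.1 Z hZ (p + 2)).2.1 hu hu0
  have hc0 : 0 < absCharge (Z (p + 2)) := absCharge_pos_of_not_isApex hσax (not_isApex_of_snd_ne hσc)
  have hcabs : cabs (Z (p + 2)) = absCharge (Z (p + 2)) := cabs_eq_absCharge hσax
  have hσ1 : (Z (p + 2)).1 = (Z p).1 + absCharge (Z (p + 2)) := by unfold nodeLevel at hσn; omega
  have hray : Z (p + 2) = ray (Z p) u (absCharge (Z (p + 2))) := by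
    rcases hE with ⟨-, hr⟩ | ⟨hneg, -⟩
    · rw [hcabs, hσ1, add_sub_cancel_right] at hr; rw [hZp]; exact hr
    · exfalso; have := (hU.1 Z hZ (p + 2)).2.1; have := absCharge_nonneg (Z (p + 2)); omega
  -- STEP A: the full descent `q`
  obtain ⟨q, hq, hqag, hqσ⟩ := flat_descent_present hU hZ (hD.1 Z hZ) hσp hp hfl hI h4 hL
  have hqp : q p = Z p := hqag p hσp.symm
  -- the swapped head `N'`
  have hN' : Z.perm (Equiv.swap p (p + 2)) ∈ C.lower := hS _ Z hZ
  have hN'p : Z.perm (Equiv.swap p (p + 2)) p = Z (p + 2) := by simp [MCell.perm, Equiv.swap_apply_left]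
  have hN'σ : Z.perm (Equiv.swap p (p + 2)) (p + 2) = Z p := by simp [MCell.perm, Equiv.swap_apply_right]
  -- every `P ∈ C.upper` null-below `Z σ` in a direction is four-charged ∕ interface ∕ low-two unless it is the full descent in direction `u`
  -- STEP B
  refine hA Z hZ q hq _ hN' (p + 2) u p u ⟨not_isApex_of_snd_ne hσc, hE, ?_, fun _ => ?_, hσp.symm, ?_, ?_, ?_, ?_, ?_, ?_⟩
  · -- (3) `q` is the u-partner of `Z` at σ
    refine ⟨hqag, by rw [hqσ]; omega, ?_⟩
    rw [hqσ, hσ1, add_sub_cancel_left]; exact hray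
  · -- (4) the charge guard `c ≤ c`
    rw [hqσ, hcabs]; omega
  · -- (6) `q` is the u-partner of `N'` at `p`
    refine ⟨fun e he => ?_, by rw [hqp, hN'p]; omega, ?_⟩
    · by_cases hes : e = p + 2
      · rw [hes, hN'σ, hqσ]
      · show q e = Z (Equiv.swap p (p + 2) e)
        rw [Equiv.swap_apply_of_ne_of_ne he hes, hqag e hes]
    · rw [hN'p, hqp, hσ1, add_sub_cancel_left]; exact hray
  · -- (7) no partner of `Z` at σ in another direction
    rintro P hP w hwu ⟨hagP, hlt, hrayP⟩
    have hd : 0 < (Z (p + 2)).1 - (P (p + 2)).1 := by omega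
    have hyax := (hU.2 P hP (p + 2)).1
    have hy := (hU.2 P hP (p + 2)).2.1
    by_cases hw2 : w = u + 2
    · -- node partner: a drop — charged, node `< ℓ`, top `= top(Z σ) > ℓ`: interface
      rw [hw2] at hrayP
      have hm0 : coord (Z (p + 2)) (u + 2) = (Z (p + 2)).1 - absCharge (Z (p + 2)) := by
        have := coord_add_coord_add_two (Z (p + 2)) u; omega
      obtain ⟨hyc, hyt, hyn⟩ := nodeChild_full hσax hσc (adapted_add_two hu) hm0 hd hrayP hyax hy
      -- `P` = Z[σ ↦ y]: apex p, every other letter charged with top > ℓ: interface (node(y) < ℓ makes it still `LowApexP`)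
      have hPp : P p = Z p := hagP p hσp.symm
      have hch : ∀ e, e ≠ p → (P e).2 ≠ (0, 0) := fun e he => by
        by_cases hes : e = p + 2
        · rw [hes]; exact hyc
        · rw [hagP e hes]; exact (hlet e he).1
      have hlow : ∀ e, e ≠ p → (P e).2 ≠ (0, 0) ∧ nodeLevel (P p) < causalTop (P e) := fun e he => ⟨hch e he, by
        rw [hPp, hnp]; by_cases hes : e = p + 2
        · rw [hes, hyt]; exact hσt
        · rw [hagP e hes]; exact (hlet e he).2.2⟩
      have hnl : ¬ LevelCell P := fun hl => by have := hl p (p + 2); rw [hPp, htp, hyt] at this; omega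
      exact hI.2 P hP (Or.inl ⟨chargeCount_ge_three hch, hnl⟩) ⟨p, by rw [hPp]; exact hp, hlow⟩
    · rcases topChild_full hσax hσc hu hu0 hw2 hd hrayP hyax hy with ⟨hdn, hdt, hdc⟩ | ⟨hoc, hot, hon, -⟩
      · by_cases hσ0 : (P (p + 2)).2 = (0, 0)
        · -- a full descent in direction `w ≠ u`: impossible, the apex `ℓI` is reached from `Z σ` only in direction `u`
          have h0 : absCharge (P (p + 2)) = 0 := absCharge_of_uncharged hσ0
          obtain ⟨heq, hnn, -⟩ := apex_data hσ0
          have h1 : (P (p + 2)).1 = (Z p).1 := by rw [← hnn, hdn, hσn]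
          rw [heq, h1, show (Z (p + 2)).1 - (Z p).1 = absCharge (Z (p + 2)) by omega] at hrayP
          rw [hZp] at hray
          exact hwu (ray_apex_dir_inj (ne_of_gt hc0) (hrayP.symm.trans hray))
        · exact flat_partialDesc_absent hU hlet hp hnp hI hP hσp hagP hσ0 (by rw [hdn, hσn])
      · exact flat_topAt_absent hlet hp htp hL hP hσp hagP hoc (by rw [hot, hσn])
  · -- (8) `q σ = ℓI` is the TOPMOST u-partner position: a partner above it would be a partial descent (interface)
    rintro P hP ⟨hagP, hlt, hrayP⟩
    rw [hqσ]
    refine le_of_not_gt fun hgt => ?_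
    have hd : 0 < (Z (p + 2)).1 - (P (p + 2)).1 := by omega
    have hyax := (hU.2 P hP (p + 2)).1
    have hy := (hU.2 P hP (p + 2)).2.1
    rcases topChild_full hσax hσc hu hu0 (fin4_ne_add_two u) hd hrayP hyax hy with ⟨hdn, hdt, hdc⟩ | ⟨hoc, hot, hon, -⟩
    · by_cases hσ0 : (P (p + 2)).2 = (0, 0)
      · obtain ⟨-, hnn, -⟩ := apex_data hσ0
        rw [← hnn, hdn, hσn] at hgt; exact lt_irrefl _ hgt
      · exact flat_partialDesc_absent hU hlet hp hnp hI hP hσp hagP hσ0 (by rw [hdn, hσn])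
    · have : (P (p + 2)).1 ≤ causalTop (P (p + 2)) := by unfold causalTop; have := absCharge_nonneg (P (p + 2)); omega
      rw [hot, hσn] at this; omega
  · -- (9) nothing DEEPER on the u-line below `q σ = ℓI`: such a partner of `q` would be a low-two cell (charged letter of top ℓ at σ)
    rintro P hP ⟨hagP, hlt, hrayP⟩
    rw [hqσ] at hlt hrayP
    rw [hZp] at hrayP
    have hd : 0 < (Z p).1 - (P (p + 2)).1 := by omega
    obtain ⟨hyc, hyt, -⟩ := apexLower_of_ray hd hrayP
    exact flat_topAt_absent hlet hp htp hL hP hσp (fun g hg => by rw [hagP g hg, hqag g hg]) hyc hyt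
  · -- (10) (A1W) no `P` is null-below the apex `Z p = ℓI` at slot `p` (agreeing off `p`, or off `{p, g}` with `P g` null-below `Z g`)
    intro P hP hnb hor
    exfalso
    rw [hZp] at hnb
    obtain ⟨hpc, hpt⟩ := nullBelow_apexPt (hU.2 P hP p).1 hnb
    obtain ⟨e3, he3p, he3σ⟩ := exists_third p (p + 2)
    rcases hor with hagP | ⟨g, hgp, hag2, hnbg⟩
    · exact flat_fourCharged_absent hlet h4 hP (fun e hes hep => hagP e hep) hpc (by rw [hagP _ hσp]; exact hσc)
        (a := p) (b := p + 2) (by rw [hpt, hagP _ hσp]; exact ne_of_lt hσt)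
    · obtain ⟨e4, he4p, he4g⟩ := exists_third p g
      have hP4 : (Z p).1 < causalTop (P e4) := by rw [hag2 e4 he4p he4g]; exact (hlet e4 he4p).2.2
      by_cases hg0 : (P g).2 = (0, 0)
      · -- `P g` an apex null-below the charged `Z g`: it is `ℓI`; `P` is the swapped low-two cell
        obtain ⟨heq, -, -⟩ := apex_data hg0
        rw [heq] at hnbg
        have ha := apexPt_nullBelow_letter (hU.1 Z hZ g).1 (hlet g hgp).1 hnbg
        rw [(hlet g hgp).2.1] at ha
        exact flat_swapAt_absent hlet hL hP hgp hag2 hpc hpt (by rw [heq, ha])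
      · exact flat_fourCharged_absent hlet h4 hP (fun e heg hep => hag2 e hep heg) hpc hg0 (a := p) (b := e4)
          (by rw [hpt]; exact ne_of_lt hP4)
  · -- (11) no polluter: `P` agreeing off `{σ, p}` with `P σ` on the u-line at or below `ℓI` and `P p` (3b) strictly up the u-ray from `ℓI`, or (3d) spacelike to it
    intro P hP hagP hul
    -- `P σ` is `ℓI` itself or a charged letter of causal top `ℓ`
    have hPσ : P (p + 2) = Z p ∨ ((P (p + 2)).2 ≠ (0, 0) ∧ causalTop (P (p + 2)) = (Z p).1) := by
      obtain ⟨hle, hr⟩ := hul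
      rw [hqσ] at hle hr
      rcases lt_or_eq_of_le hle with hlt' | heq
      · right; rw [hZp] at hr
        obtain ⟨hyc, hyt, -⟩ := apexLower_of_ray (by omega : 0 < (Z p).1 - (P (p + 2)).1) hr
        exact ⟨hyc, hyt⟩
      · left; rw [heq, sub_self, ray_zero] at hr; exact hr.symm
    -- in either case a CHARGED `p`-letter with causal top `≠ ℓ` is fatal: interface (apex at σ) or four-charged non-level
    have fatal : (P p).2 ≠ (0, 0) → (Z p).1 < causalTop (P p) → False := fun hpc hpt => by
      rcases hPσ with e | ⟨hc', ht'⟩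
      · -- apex at σ (level ℓ), all others charged with tops > ℓ: interface
        have hσ0 : (P (p + 2)).2 = (0, 0) := by rw [e]; exact hp
        have hch : ∀ f, f ≠ p + 2 → (P f).2 ≠ (0, 0) := fun f hf => by
          by_cases hfp : f = p; · rw [hfp]; exact hpc
          rw [hagP f hf hfp]; exact (hlet f hfp).1
        have hlow : ∀ f, f ≠ p + 2 → (P f).2 ≠ (0, 0) ∧ nodeLevel (P (p + 2)) < causalTop (P f) := fun f hf => ⟨hch f hf, by
          rw [e, hnp]; by_cases hfp : f = p; · rw [hfp]; exact hpt
          rw [hagP f hf hfp]; exact (hlet f hfp).2.2⟩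
        have hnl : ¬ LevelCell P := fun hl => by have := hl (p + 2) p; rw [e, htp] at this; omega
        exact hI.2 P hP (Or.inl ⟨chargeCount_ge_three hch, hnl⟩) ⟨p + 2, hσ0, hlow⟩
      · exact flat_fourCharged_absent hlet h4 hP hagP hpc hc' (a := p + 2) (b := p) (by rw [ht']; exact ne_of_lt hpt)
    refine ⟨fun h3b => ?_, fun h3d => ?_⟩
    · -- (3b) `P p = ℓI + j·n_u`, `j > 0`: charged, node ℓ, top ℓ + 2j
      obtain ⟨hj, -, hr⟩ := h3b
      rw [hZp] at hr
      have hj' : 0 < (P p).1 - (Z p).1 := by omega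
      obtain ⟨hyc, -, hyt⟩ := ray_up_apexPt hj' u
      rw [← hr] at hyc hyt
      exact fatal hyc (by rw [hyt]; omega)
    · -- (3d) `P p` spacelike to `ℓI`: charged, straddling ℓ
      obtain ⟨-, hsp⟩ := h3d
      rw [hZp] at hsp
      obtain ⟨hyc, -, hya⟩ := spacelike_apexPt (hU.2 P hP p).1 hsp
      exact fatal hyc hya

/-- **(F1) ⟸ interface ∧ four-charged(`P`) under RULE D + A2I⁻ + S₄** (KERNEL, `h` even, `h`-uniform): the node-flat one-apex `K_N`-family is
absent in every `◇_h` design obeying RULE D, the A2I⁻ static law and `N`-level slot symmetry in which the interface one-apex `K`-cells and the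
four-charged `K_P`-cells are absent (the low-two cells are removed by §4).  With `PairSpread` v12 (`fourChargedK_absent_of_interface`,
`kAbsent_iff_core`) this is `KAbsent ⟸ InterfaceKAbsent ∧ TwinApexKAbsent` under the same laws. -/
theorem flatApex_absent {h : ℤ} (hh : h % 2 = 0) {C : MConfig} (hU : C.InDiamond h) (hD : RuleDMu4Closed C) (hA : A2IMinusClosed C)
    (hS : PermClosed C.lower) (hI : InterfaceKAbsent C) (h4 : FourChargedKAbsent C) : F1Absent C :=
  flatApex_absent_of_lowTwo hU hD hA hS hI h4.2 (lowTwoK_absent_of_fourCharged hh hU hD h4).2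

/-- the same with the `G₁`∕`H₁`-static design laws of the crux displayed as they appear in `SeedB1OddDiamondG1H1` (`G1Closed`, `StaticH1`). -/
theorem flatApex_absent_of_laws {h : ℤ} (hh : h % 2 = 0) {C : MConfig} (hU : C.InDiamond h) (hG : C.G1Closed) (hH : C.StaticH1)
    (hI : InterfaceKAbsent C) (h4 : FourChargedKAbsent C) : F1Absent C :=
  flatApex_absent hh hU hH.1 hH.2.2 hG.1 hI h4

end Summit.HodgeConjecture.HodgeConjecture.Cruxes.BlochSeedDiscOne.FlatApex
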